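import Mathlib
import HarnessLib
import Literature.Analysis.FluidPDE.ParasiticSlabFlow
import Summits.NavierStokesRegularity.NavierStokesRegularity.Theorems.FluxZoom.Negative.StubFluxVelocityFalseWithoutL2

/-!
# Crux `PoloidalWindowRigidity` (K2, stmt-NavierStokesRegularity-19708, route `PoloidalWindowDoor`) — the Oseen-mild
# identity is LOAD-BEARING: K2 with that one hypothesis deleted is FALSE

Negative-side support (refuter seat ns-regularity-refuter1, cell ns-regularity-ideate; D-0081 §C). The crux text
`Summit.NavierStokesRegularity.NavierStokesRegularity.Theses.PoloidalWindowDoor.PoloidalWindowRigidity` has four class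
hypotheses on the profile `v : (−∞,0) × ℝ³ → ℝ³` — (R) Type-I time rate, (C) continuity on the open backward slab,
(M) the unit-viscosity Oseen-mild identity between negative times, (D) divergence-free slices — and concludes: vorticity
slices continuous, and for every `e ≠ 0`, poloidality along `e` on an open window of every slice excludes a backward
singularity at the apex.

`poloidalWindowRigidity_false_without_mild`: delete (M) and the statement is false. Witness: the spatially constant
parasitic drift `v(t, x) = (−t)^{-1/2} e₀` of Koch–Nadirashvili–Seregin–Šverák 2009, §1 p. 3 (tree
`Literature.Analysis.FluidPDE.parasiticVelocity 1`): it has the Type-I rate with constant `1`, is smooth on the slab,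
has divergence-free and CURL-FREE slices (so it is poloidal along EVERY direction, everywhere, on every slice), and is
backward-singular at the apex (tree `parasitic_isBackwardSingularPoint_zero`). Hence any proof of K2 must use (M) — and
must use it beyond slice regularity, since the witness has smooth slices. (The witness violates (M): a bounded caloric
function with the Type-I rate at `−∞` vanishes, cf. the route file's kernel remark.)

`exists_poloidal_typeI_singular_profile` is the positive form of the same fact (an explicit profile with (R), (C), (D),
everywhere-poloidal continuous vorticity slices and a backward singularity at the apex).

WHAT THIS IS NOT: not a claim about Navier–Stokes regularity and not a refutation of K2 — a kernel-checked certificate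
that hypothesis (M) of K2 cannot be dropped (information for the K2 lead's line census).
-/

noncomputable section

-- the summit and its single sub-problem share the name (CONVENTIONS §1), as in every Theorems file
set_option linter.dupNamespace false

namespace Summit.NavierStokesRegularity.NavierStokesRegularity.Theorems.PoloidalWindowRigidity.Negative

open MeasureTheory Set Function Filter Topology Metric
open scoped RealInnerProductSpace InnerProductSpace
open Literature.Analysis Literature.Analysis.FluidPDE

/-- Every slice of the parasitic drift is the constant field `b₁(t) e₀`. [folklore] -/
theorem parasiticVelocity_slice (t : ℝ) :
    parasiticVelocity 1 t = fun _ : EuclideanSpace ℝ (Fin 3) => parasiticAmp 1 t • parasiticDir := rfl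

/-- The vorticity of every slice of the parasitic drift vanishes identically. [folklore] -/
theorem curl_parasiticVelocity (t : ℝ) (x : EuclideanSpace ℝ (Fin 3)) :
    curl (parasiticVelocity 1 t) x = 0 := by
  rw [parasiticVelocity_slice]
  exact FluxZoom.Negative.curl_constField _ x

/-- **An explicit profile with every hypothesis of K2 except the Oseen-mild identity, poloidal along every direction,
and backward-singular at the apex**: the parasitic drift `(−t)^{-1/2} e₀` (KNSS 2009, §1 p. 3). [folklore] -/
theorem exists_poloidal_typeI_singular_profile :
    ∃ (C : ℝ) (v : ℝ → EuclideanSpace ℝ (Fin 3) → EuclideanSpace ℝ (Fin 3)),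
      HasTypeITimeDecay C v ∧
      ContinuousOn (Function.uncurry v) (Set.Iio (0 : ℝ) ×ˢ Set.univ) ∧
      (∀ t < 0, VectorCalculus.IsDivFree (v t)) ∧
      (∀ s < 0, Continuous (curl (v s))) ∧
      (∀ (e : EuclideanSpace ℝ (Fin 3)), ∀ s < 0, ∀ y, ⟪curl (v s) y, e⟫_ℝ = 0) ∧
      IsBackwardSingularPoint v 0 := by
  refine ⟨1, parasiticVelocity 1, parasitic_hasTypeITimeDecay zero_le_one,
    (contDiffOn_parasiticVelocity 1 (n := 0)).continuousOn, fun t _ => isDivFree_parasiticVelocity 1 t,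
    fun s _ => ?_, fun e s _ y => ?_, parasitic_isBackwardSingularPoint_zero one_pos⟩
  · have h : curl (parasiticVelocity 1 s) = fun _ => 0 := funext (curl_parasiticVelocity s)
    rw [h]
    exact continuous_const
  · rw [curl_parasiticVelocity, inner_zero_left]

/-- **K2 without the Oseen-mild identity is FALSE.** The statement below is VERBATIM the Theses decl
`…Theses.PoloidalWindowDoor.PoloidalWindowRigidity` with its third hypothesis (the unit-viscosity Oseen-mild identity
`v t x = heatExtension (v s) (t − s) x − oseenDuhamel 1 s v v t x` for `s < t < 0`) deleted; the parasitic drift refutes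
it (take `e = e₀`, window `univ` on every slice). So hypothesis (M) of K2 is load-bearing. [folklore] -/
theorem poloidalWindowRigidity_false_without_mild :
    ¬ (∀ (C : ℝ) (v : ℝ → EuclideanSpace ℝ (Fin 3) → EuclideanSpace ℝ (Fin 3)),
        HasTypeITimeDecay C v →
        ContinuousOn (Function.uncurry v) (Set.Iio (0 : ℝ) ×ˢ Set.univ) →
        (∀ t < 0, VectorCalculus.IsDivFree (v t)) →
        (∀ s < 0, Continuous (curl (v s))) ∧
          ∀ (e : EuclideanSpace ℝ (Fin 3)), e ≠ 0 →
            (∀ s < 0, ∃ U : Set (EuclideanSpace ℝ (Fin 3)), IsOpen U ∧ U.Nonempty ∧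
              ∀ y ∈ U, ⟪curl (v s) y, e⟫_ℝ = 0) →
            ¬ IsBackwardSingularPoint v 0) := by
  intro h
  obtain ⟨C, v, hR, hC, hD, -, hpol, hsing⟩ := exists_poloidal_typeI_singular_profile
  have he : (EuclideanSpace.single 0 1 : EuclideanSpace ℝ (Fin 3)) ≠ 0 := by
    intro h0
    have := congrArg (fun w : EuclideanSpace ℝ (Fin 3) => w 0) h0
    simp at this
  exact (h C v hR hC hD).2 _ he
    (fun s hs => ⟨Set.univ, isOpen_univ, univ_nonempty, fun y _ => hpol _ s hs y⟩) hsing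

end Summit.NavierStokesRegularity.NavierStokesRegularity.Theorems.PoloidalWindowRigidity.Negative

end
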